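import Summits.AnomalousDissipation.AnomalousDissipation.Cruxes.KolmogorovFloor.SketchIdeator3

/-!
# Sketch — crux-ideate round 2, ideator 4, crux `TaylorCertificates.KolmogorovFloor`
(stmt-AnomalousDissipation-14030) — card `cheap-steady-euler-closure` (NEGATIVE lever: the ∀f closure)

Companion of `idea-cheap-steady-euler-closure.md` (this seat). Typed against the LIVE route file (rev 12) through
`Cruxes/KolmogorovFloor/SketchIdeator3.lean` (round 1, ideator 3: `FloorKillAtFor`, `slopeSum`, `SlopeLE`,
`IsEulerShear`, `not_kolmogorovFloor_of_kill`, `DressedRayLaw`), whose objects are reused verbatim.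

What is here.
* §1 `LacunaryFrameAt L` / `LacunaryFrame` — FIRST LEMMA (pure arithmetic): the explicit ν-free lattice frame
  `ξ_L = (L, 3L²+1, 20L⁴)`, `e_L = (3L²+1 + 20(L+1)L⁴, −L, −L(L+1))`, `n_L = ξ_L × e_L` has `ξ_L ⊥ e_L` and makes
  EVERY lattice mode `0 < |k|_∞ ≤ L` admissible (`k·e ≠ 0`, `k·n ≠ 0`) and non-resonant (`|k|² ≠ 2|k·ξ|`) at
  once — by size comparison only. `lacunaryFrameAt_one` is kernel-checked (27 cases); brute force `L ≤ 8` in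
  `toy/frame_check.out`.
* §2 `CheapSteadyEulerStates` — the ν-FREE, certificate-free, skeleton-free interface: every smooth solenoidal
  mean-zero force is `(a·∇)a` up to `η` in the beat-dual pairing, at a div-free mean-zero trigonometric
  polynomial `a` of enstrophy/degree/energy `≤ η^{-11/10}`, slope `≤ η^{-3/5}`, and `|(a,f)| ≤ η^{2/5}`.
* §3 `EndgameFromCheapStates` — THEOREM A′: cheap states ⇒ `FloorKillAtFor (3/4) f` for every admissible `f`
  (DRESSED-RAY-r1-3 §2 Steps 0–3 with `ν := η^{3/2}`; the landed invisible beat closes). Logic to `¬KolmogorovFloor`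
  PROVED (`not_kolmogorovFloor_of_cheap`, `dressedRayLaw_of_cheap`).
* §4 `ApproxLinearResponseWith`, `TallFrameResponse` (E2: the inviscid linear response of the tall shear
  `U_L = sin(2π ξ_L·x) ê_L` to every force of degree `≤ L`, ALL mode lines in the oscillatory regime with ONE mode
  each, critical-layer constants in closed form `Σ_{j even/odd} 1/(w²−(j+τ)²) = (π/2w)·sin(πw)/(±cos πτ − cos πw)`,
  constants `poly(L)`; numerics `toy/tall_frame_response.out`), `CheapOfTallFrames` (E3: far-field assembly
  `a = (t/|ξ|)U + (|ξ|/t) b_K` at `L = η^{-σ'}`), and the composed logic `not_kolmogorovFloor_of_stubs` PROVED.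

No analytic statement below is claimed proved in Lean; §1's `L = 1` instance and all the logic are.
-/

noncomputable section

set_option linter.dupNamespace false

open MeasureTheory UnitAddTorus
open scoped InnerProductSpace ENNReal BigOperators

namespace Summit.AnomalousDissipation.AnomalousDissipation.Cruxes.KolmogorovFloor.Ideator4R2

open Literature.Analysis.FunctionSpaces Literature.Analysis.FluidPDE
open Summit.AnomalousDissipation.AnomalousDissipation.Theses.TaylorCertificates
open Summit.AnomalousDissipation.AnomalousDissipation.Cruxes.KolmogorovFloor.Ideator3

local notation "𝕋³" => UnitAddTorus (Fin 3)
local notation "E³" => EuclideanSpace ℝ (Fin 3)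
local notation "L2T" => Lp (EuclideanSpace ℝ (Fin 3)) 2 (volume : Measure (UnitAddTorus (Fin 3)))

/-! ## §1  FIRST LEMMA — the lacunary frame (pure arithmetic, ν-free, force-free) -/

/-- **Lacunary frame at height `L`.** With `ξ = (L, 3L²+1, 20L⁴)`, `e = (3L²+1 + 20(L+1)L⁴, −L, −L(L+1))` and
`n = ξ × e` (components written out): `ξ·e = 0`, and every integer mode `k ≠ 0` with `|kᵢ| ≤ L` satisfies the three
admissibility / non-resonance conditions of the inviscid linear response of the shear `sin(2π ξ·x) ê`:
`k·e ≠ 0` (streamwise wavenumber `α ≠ 0`), `k·n ≠ 0` (spanwise wavenumber `ζ ≠ 0`: the lift-up coupling at the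
critical layers), and `|k|² ≠ 2|k·ξ|` (no lattice point of norm `|ξ|` on the line `k + ℤξ`, i.e. the divisors
`d_{±1} = 4π²(|ξ|² − |k ± ξ|²)` do not vanish). Paper proof for all `L ≥ 1`: three size comparisons
(`20L⁴ > L(L + 3L² + 1) + 2L²`, `3L² + 1 − L² > 2L²·…`, `2L > L`) and the lacunarity of the coordinates of `e`, `n`. -/
def LacunaryFrameAt (L : ℕ) : Prop :=
  ∀ k₁ k₂ k₃ : ℤ, |k₁| ≤ L → |k₂| ≤ L → |k₃| ≤ L → (k₁ ≠ 0 ∨ k₂ ≠ 0 ∨ k₃ ≠ 0) →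
    let ξ₁ : ℤ := L
    let ξ₂ : ℤ := 3 * L ^ 2 + 1
    let ξ₃ : ℤ := 20 * L ^ 4
    let e₁ : ℤ := 3 * L ^ 2 + 1 + 20 * (L + 1) * L ^ 4
    let e₂ : ℤ := -L
    let e₃ : ℤ := -(L * (L + 1))
    let n₁ : ℤ := ξ₂ * e₃ - ξ₃ * e₂
    let n₂ : ℤ := ξ₃ * e₁ - ξ₁ * e₃
    let n₃ : ℤ := ξ₁ * e₂ - ξ₂ * e₁
    ξ₁ * e₁ + ξ₂ * e₂ + ξ₃ * e₃ = 0 ∧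
    k₁ * e₁ + k₂ * e₂ + k₃ * e₃ ≠ 0 ∧
    k₁ * n₁ + k₂ * n₂ + k₃ * n₃ ≠ 0 ∧
    2 * |k₁ * ξ₁ + k₂ * ξ₂ + k₃ * ξ₃| ≠ k₁ ^ 2 + k₂ ^ 2 + k₃ ^ 2

/-- The lacunary frame lemma for every height (paper: size comparisons; brute-forced for `L ≤ 8`). -/
def LacunaryFrame : Prop := ∀ L : ℕ, 1 ≤ L → LacunaryFrameAt L

/-- Kernel-checked instance `L = 1` (`ξ = (1,4,20)`, `e = (44,−1,−2)`, `n = (12, 882, −177)`): the 26 modes of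
the unit cube are admissible and non-resonant. -/
theorem lacunaryFrameAt_one : LacunaryFrameAt 1 := by
  intro k₁ k₂ k₃ h₁ h₂ h₃ hne
  simp only [Nat.cast_one] at h₁ h₂ h₃
  obtain ⟨h₁l, h₁u⟩ := abs_le.mp h₁
  obtain ⟨h₂l, h₂u⟩ := abs_le.mp h₂
  obtain ⟨h₃l, h₃u⟩ := abs_le.mp h₃
  revert hne
  interval_cases k₁ <;> interval_cases k₂ <;> interval_cases k₃ <;> norm_num

/-! ## §2  The ν-free interface: CHEAP APPROXIMATE STEADY EULER STATES -/

/-- **CHEAP STEADY EULER STATES** (ν-free, certificate-free, skeleton-free). For every smooth solenoidal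
mean-zero force `f` and every small `η > 0` there is a smooth solenoidal mean-zero trigonometric polynomial `a`
of degree `K ≤ η^{-11/10}` with

* Euler defect `≤ η` in the beat-dual pairing: `|((a·∇)a − f, W)| ≤ η·M` for every band-limited solenoidal
  mean-zero `W` with resolved slope `|k|‖Ŵ(k)‖ ≤ M` (gradients pair to zero with solenoidal `W`: no pressure);
* enstrophy `‖∇a‖² ≤ η^{-11/10}`, weighted slope `Σ_{|k|≤K}|k|‖â(k)‖ ≤ η^{-3/5}`, energy `‖a‖² ≤ η^{-11/10}`;
* almost no work: `|(a, f)| ≤ η^{2/5}`.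

I.e. defect² × enstrophy `≤ η^{9/10} → 0`: strictly below the one-stage Beltrami–Nash borderline
(defect `1/λ`, enstrophy `λ²`; Disproof (F4) regime II), for EVERY force. Paper proof (card §Lever, E1–E3): far
field `a = (t/|ξ|)U + (|ξ|/t)P_K b` over the lacunary shear frame of height `L = η^{-σ'}`, `b` the inviscid
linear response (all mode lines oscillatory, one mode each, closed-form layer constants), the `O(L^{-s})` tail of
`f̂` thrown into the defect. The negation for one `f` is exactly the quantitative Euler coercivity `𝔐*(f) > 0`
that Disproof (F4)(i) shows the crux needs. -/
def CheapSteadyEulerStates : Prop :=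
  ∀ f : 𝕋³ → E³, Torus.IsSmooth f → Torus.IsDivFree f → Torus.HasZeroMean f →
    ∃ η₀ : ℝ, 0 < η₀ ∧ ∀ η : ℝ, 0 < η → η < η₀ →
      ∃ (K : ℕ) (a : 𝕋³ → E³), Torus.IsSmooth a ∧ Torus.IsDivFree a ∧ Torus.HasZeroMean a ∧
        Torus.fourierTruncate K a = a ∧ (K : ℝ) ≤ η ^ (-(11 / 10 : ℝ)) ∧
        Torus.gradNormSq a ≤ η ^ (-(11 / 10 : ℝ)) ∧ slopeSum K a ≤ η ^ (-(3 / 5 : ℝ)) ∧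
        (∫ x, ‖a x‖ ^ 2) ≤ η ^ (-(11 / 10 : ℝ)) ∧ |∫ x, ⟪a x, f x⟫_ℝ| ≤ η ^ ((2 / 5 : ℝ)) ∧
        ∀ (D : ℕ) (W : 𝕋³ → E³) (M : ℝ), Torus.IsSmooth W → Torus.IsDivFree W → Torus.HasZeroMean W →
          Torus.fourierTruncate D W = W → SlopeLE W M →
          |∫ x, ⟪Torus.convect a a x - f x, W x⟫_ℝ| ≤ η * M

/-! ## §3  THEOREM A′ — the endgame from cheap states, and the logic to `¬KolmogorovFloor` -/

/-- **THEOREM A′ (endgame from cheap states).** Paper (= DRESSED-RAY-r1-3 §2 Steps 0–3 with the ray replaced by a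
cheap state and `ν := η^{3/2}`): given admissible `f` and `ε₀, C, Θ, ν₀`, take `η` small and `a` cheap; then
`D_a = ν‖∇a‖² ≤ η^{2/5}`, `2Θ|(a,f)| ≤ 2Θη^{2/5}`, `den := 4π²ν·slope + η = O(η^{9/10})`, beat price
`Π ≤ 8π²(1+2Θ)(9C²ν^{-1/2} + ν(K+2)²) = O(η^{-3/4})`, so `den·Π = O(η^{3/20}) → 0`; Step 1: FLOOR(a) `≥ ε₀`
forces `den·M_W ≥ 3ε₀/4`; Step 2–3: the coords-invisible axis beat at the largest resolved coefficient of
`W = Φ₁'(a)` (landed `Negative/AxisBeat*`, carriers above `N + K`) violates FLOOR at `a + tw`, `t² = κ'·den ≤ 1`,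
inside the Leray ball (`‖a‖² + 1 ≤ η^{-11/10} + 1 ≤ 16‖f‖²η^{-3}`). Lean size M given the endgame with a general
trigonometric-polynomial base state (the same generalisation every negative line of this crux asks for). -/
def EndgameFromCheapStates : Prop :=
  CheapSteadyEulerStates →
    ∀ f : 𝕋³ → E³, Torus.IsSmooth f → Torus.IsDivFree f → Torus.HasZeroMean f → FloorKillAtFor (3 / 4) f

/-- Logic (PROVED): cheap states + the endgame give the full-force DRESSED-RAY LAW of round 1 … -/
theorem dressedRayLaw_of_cheap (hC : CheapSteadyEulerStates) (hE : EndgameFromCheapStates) : DressedRayLaw :=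
  hE hC

/-- … and refute the crux BY NAME. -/
theorem not_kolmogorovFloor_of_cheap (hC : CheapSteadyEulerStates) (hE : EndgameFromCheapStates) :
    ¬ KolmogorovFloor :=
  not_kolmogorovFloor_of_kill (hE hC)

/-! ## §4  How CHEAP is proved: tall-frame linear response (E2) and far-field assembly (E3) -/

/-- `ApproxLinearResponse` of round 1 (ideator 3) with the constant EXPOSED (needed: its dependence on the frame
height is polynomial). Verbatim the body of `Ideator3.ApproxLinearResponse f U` under `∃ Cb`. -/
def ApproxLinearResponseWith (Cb : ℝ) (f U : 𝕋³ → E³) : Prop :=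
  ∀ K : ℕ, 1 ≤ K → ∃ b : 𝕋³ → E³,
    Torus.IsSmooth b ∧ Torus.IsDivFree b ∧ Torus.HasZeroMean b ∧ Torus.fourierTruncate K b = b ∧
    (∫ x, ‖b x‖ ^ 2) ≤ Cb ∧ slopeSum K b ≤ Cb * K ∧ Torus.gradNormSq b ≤ Cb * K ∧
    ∀ (D : ℕ) (W : 𝕋³ → E³) (M : ℝ), Torus.IsSmooth W → Torus.IsDivFree W → Torus.HasZeroMean W →
      Torus.fourierTruncate D W = W → SlopeLE W M →
      |∫ x, ⟪Torus.convect U b x + Torus.convect b U x - f x, W x⟫_ℝ| ≤ Cb / K * M ∧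
      |∫ x, ⟪Torus.convect b b x, W x⟫_ℝ| ≤ Cb * (1 + Real.log K) * M

theorem approxLinearResponse_of_with {Cb : ℝ} {f U : 𝕋³ → E³} (h : ApproxLinearResponseWith Cb f U) :
    ApproxLinearResponse f U := ⟨Cb, h⟩

/-- **E2 — TALL-FRAME RESPONSE** (paper + numerics `toy/tall_frame_response.out`). There are an exponent `p` and a
constant `B` such that for every height `L ≥ 1` and every smooth solenoidal mean-zero force `f` of degree `≤ L`,
the shear `U_L = sin(2π ξ_L·x) ê_L` of the lacunary frame (§1) is an Euler shear of degree `≤ 25L⁴` and enstrophy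
`≤ B L⁸`, EXACTLY orthogonal to `f` (`|ξ_L| > L`), carrying an approximate linear response with constant
`≤ B·L^p·(1 + ‖f‖₂²)`. Construction per mode line `k₀ + ℤξ_L` (one mode of `f` each, all lines oscillatory):
`S·h = r` (two-term recurrence, `r` supported at `j = 0`), `Ŷ_j = h_j/d_j` with INTEGER divisors
`d_j = 4π²(|ξ|² − |k₀ + jξ|²) ≠ 0` (§1), the two free constants fixed by `Y(0) = β₀`, `Y(½) = β_½` through the
closed-form layer sums `Σ_{j∈2ℤ(+1)} 1/(w² − (j+τ)²) = (π/2w) sin(πw)/(±cos πτ − cos πw)` (non-zero off resonance,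
`≥ c/|ξ|⁴`), then `Q` by (E1), `X, Z` by decaying two-term recurrences (compatibility = the two layer conditions);
log layers at `ξ·x ∈ {0, ½}` give (R1)–(R5) exactly as in the axis frame. -/
def TallFrameResponse : Prop :=
  ∃ (p : ℕ) (B : ℝ), ∀ L : ℕ, 1 ≤ L → ∀ f : 𝕋³ → E³, Torus.IsSmooth f → Torus.IsDivFree f →
    Torus.HasZeroMean f → Torus.fourierTruncate L f = f →
    ∃ U : 𝕋³ → E³, IsEulerShear U ∧ Torus.fourierTruncate (25 * L ^ 4) U = U ∧
      Torus.gradNormSq U ≤ B * (L : ℝ) ^ 8 ∧ (∫ x, ‖U x‖ ^ 2) = 1 / 2 ∧ (∫ x, ⟪U x, f x⟫_ℝ) = 0 ∧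
      ApproxLinearResponseWith (B * (L : ℝ) ^ p * (1 + ∫ x, ‖f x‖ ^ 2)) f U

/-- **E3 — FAR-FIELD ASSEMBLY** (paper, bookkeeping): tall-frame responses give cheap states for EVERY smooth
force. Given `f` and `η`: `L := ⌈η^{-σ'}⌉` with `σ' p' < 1/10` (`p'` the total polynomial degree of the losses),
`f_L := P_L f` (tail `Σ_{|k|>L}‖f̂(k)‖/|k| ≤ C_s L^{-s} ≤ η/3` for `s σ' > 1`, `f ∈ C^∞`), `U, b_K` from E2 for `f_L`,
`t² := 3|ξ|²C_b(1 + log K)/η`, `K := ⌈3C_b/η⌉`, and `a := (t/|ξ|)U + (|ξ|/t) b_K`: then `(a·∇)a − f =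
[L_U b_K − f_L] + (|ξ|²/t²)(b_K·∇)b_K − (f − f_L)` (as `(U·∇)U = 0`) has dual size `≤ η`, and enstrophy
`t²·G_U/|ξ|² + |ξ|²C_bK/t²`, slope, degree, energy, `|(a,f)| = (|ξ|/t)|(b_K,f_L)| + tiny` obey the exponents of §2
for `η < η₀(f)`. -/
def CheapOfTallFrames : Prop := TallFrameResponse → CheapSteadyEulerStates

/-- **The composed negative skeleton** (logic PROVED): E2 + E3 + A′ refute the crux by name. With §1 feeding E2,
this is the ∀f form of round 1's dressed-ray kill: `KolmogorovFloor` has NO smooth witness force at all. -/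
theorem not_kolmogorovFloor_of_stubs (h2 : TallFrameResponse) (h3 : CheapOfTallFrames)
    (hA : EndgameFromCheapStates) : ¬ KolmogorovFloor :=
  not_kolmogorovFloor_of_cheap (h3 h2) hA

/-- Sanity (PROVED): the crux's own quantifier shape is reached — every admissible force is killed in the
Kolmogorov class. -/
theorem floorKill_all_of_stubs (h2 : TallFrameResponse) (h3 : CheapOfTallFrames) (hA : EndgameFromCheapStates)
    (f : 𝕋³ → E³) (hs : Torus.IsSmooth f) (hd : Torus.IsDivFree f) (hz : Torus.HasZeroMean f) :
    FloorKillAtFor (3 / 4) f :=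
  hA (h3 h2) f hs hd hz

end Summit.AnomalousDissipation.AnomalousDissipation.Cruxes.KolmogorovFloor.Ideator4R2
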